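import Summits.Schanuel.Schanuel.Theorems.ZilberEacParamRamifiedBranchAlgebraic
import Summits.Schanuel.Schanuel.Theorems.ZilberEacGraphFibreCurveComplete
import HarnessLib

/-!
# Polynomially parametrised base curves, LXXVIII: THE MASTER THEOREM over a polynomial curve and
# EVERY FIBRE CURVE INVOLVING `t` IS DENSE (`1 ≤ deg g₀ < deg g₁`)

HONEST FRAMING.  Cell `pub-schanuel` (Zilber's Exponential-Algebraic Closedness, case ladder;
host summit Schanuel), seat 2, gen 27.  The analogues over a polynomially parametrised base curve
`(x₀, x₁) = (g₀(t), g₁(t))`, `1 ≤ deg g₀ < deg g₁`, of files LXVI and LXXIII (graphs `x₁ = p(x₀)`):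
* **`unprojectedDense_param_cycle_zeroBranch`** / **`_poleBranch`** — a cycle of branches of the
  fibre curve `Q(t, y₀) = 0` at infinity (`t = s^{-k}`, `y₀ = ψ(s) → θ ≠ 0`) and a parametrised zero
  (or pole) branch give `I(S ∩ Γ_exp) = I(S)` for `S = {(g₀(t), g₁(t), y₀, y₁) : P(t, y₀) = 0}`
  (file LXXVII against gen 25's transcendence of the logarithm of an algebraic branch, file XLVIII);
* **`unprojectedDense_param_fibreCurve`** — `P ∈ ℂ[t, y₀]` irreducible of positive `y₀`-degree,
  top row with a nonzero root, lowest row `q₀ ≠ 0` with a root ⟹ dense (Newton–Puiseux supplies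
  both local data, files LXXI–LXXII);
* **`unprojectedDense_param_fibreCurve_of_support`** — the same from the support conditions that
  the residual theorem of gen 21 (`paramFibreCurve_residual_of_not_unprojectedDense`) leaves: the
  top `t`-row of `supp P` reaches the rightmost and the leftmost `y₀`-columns, `P` involves `t`.
So over such a curve EVERY fibre curve that involves `t` has dense exponential points; the constant
fibres `y₀ = θ` (which over polynomial GRAPHS can fail to be dense) are the only candidates left —
see file LXXIX.  Complete classes of instances of an OPEN question (Mantova–Masser, PLMS 2024 §1
p. 5); EC(3,2) OPEN; NOT Schanuel's conjecture (neither used nor implied); EAC ⇏ SC.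
-/

noncomputable section

open Filter Topology Set Complex MvPolynomial
open Literature.NumberTheory.Transcendental Literature.ModelTheory.Zilber
open Literature.ModelTheory.ExponentialFields

set_option linter.dupNamespace false

namespace Summit.Schanuel.Schanuel.Theorems

/-! ## Part A. The master theorems over a polynomial curve -/

section Master

variable (g₀ g₁ : Polynomial ℂ)

/-- **Cycle at infinity + parametrised zero branch ⟹ dense, over a polynomial curve.**
[cite: MantovaMasser2023, §1 Further remarks, p. 5 (the question, open in general)] (new) -/
theorem unprojectedDense_param_cycle_zeroBranch (hd : 1 ≤ g₀.natDegree)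
    (hlt : g₀.natDegree < g₁.natDegree) (Q : Polynomial (Polynomial ℂ))
    {P : MvPolynomial (Fin 2) ℂ}
    (hP : ∀ x y : ℂ, MvPolynomial.eval ![x, y] P = (Q.map (Polynomial.evalRingHom x)).eval y)
    (hirr : Irreducible P) (hQ1 : Q.natDegree ≠ 0) {k : ℕ} (hk : 1 ≤ k)
    {ψ : ℂ → ℂ} (hψ : AnalyticAt ℂ ψ 0) {θ : ℂ} (hθ0 : θ ≠ 0) (hψ0 : ψ 0 = θ)
    (hbranch : ∀ᶠ s in 𝓝[≠] (0 : ℂ), (Q.map (Polynomial.evalRingHom (s ^ k)⁻¹)).eval (ψ s) = 0)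
    {γ η : ℂ → ℂ} (hγan : AnalyticAt ℂ γ 0) (hηan : AnalyticAt ℂ η 0) (hη0 : η 0 = 0)
    (hγ' : ∀ᶠ t in 𝓝[≠] (0 : ℂ), deriv γ t ≠ 0) (hηne : ¬ ∀ᶠ t in 𝓝 (0 : ℂ), η t = 0)
    (hQγ : ∀ᶠ t in 𝓝 (0 : ℂ), (Q.map (Polynomial.evalRingHom (γ t))).eval (η t) = 0) :
    UnprojectedDense {w : Fin 2 ⊕ Fin 2 → ℂ | ∃ t : ℂ, w (Sum.inl 0) = g₀.eval t ∧
      w (Sum.inl 1) = g₁.eval t ∧ MvPolynomial.eval ![t, w (Sum.inr 0)] P = 0} := by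
  by_contra hnot
  have hQirr : Irreducible Q := (irreducible_rows_iff hP).1 hirr
  obtain ⟨z₀, ρ, L, hLan, hρan, hρ0, hQρ, hL, hLalg⟩ :=
    exists_algebraic_log_of_not_dense_ramified_param g₀ g₁ hd hlt Q hP hirr hQ1 hk hψ hθ0 hψ0 hbranch
      hnot
  exact not_isAlgebraic_log_algebraicBranch_param Q hQirr hQ1 hγan hηan hη0 hγ' hηne hQγ hρan hLan
    hρ0 hQρ hL hLalg

/-- **Cycle at infinity + parametrised pole branch ⟹ dense, over a polynomial curve**
(`q₀ ≠ 0`, `y₀ = 1/η(t)`).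
[cite: MantovaMasser2023, §1 Further remarks, p. 5 (the question, open in general)] (new) -/
theorem unprojectedDense_param_cycle_poleBranch (hd : 1 ≤ g₀.natDegree)
    (hlt : g₀.natDegree < g₁.natDegree) (Q : Polynomial (Polynomial ℂ))
    {P : MvPolynomial (Fin 2) ℂ}
    (hP : ∀ x y : ℂ, MvPolynomial.eval ![x, y] P = (Q.map (Polynomial.evalRingHom x)).eval y)
    (hirr : Irreducible P) (hQ1 : Q.natDegree ≠ 0) (hQ00 : Q.coeff 0 ≠ 0) {k : ℕ} (hk : 1 ≤ k)
    {ψ : ℂ → ℂ} (hψ : AnalyticAt ℂ ψ 0) {θ : ℂ} (hθ0 : θ ≠ 0) (hψ0 : ψ 0 = θ)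
    (hbranch : ∀ᶠ s in 𝓝[≠] (0 : ℂ), (Q.map (Polynomial.evalRingHom (s ^ k)⁻¹)).eval (ψ s) = 0)
    {γ η : ℂ → ℂ} (hγan : AnalyticAt ℂ γ 0) (hηan : AnalyticAt ℂ η 0) (hη0 : η 0 = 0)
    (hγ' : ∀ᶠ t in 𝓝[≠] (0 : ℂ), deriv γ t ≠ 0) (hηne : ¬ ∀ᶠ t in 𝓝 (0 : ℂ), η t = 0)
    (hQγ : ∀ᶠ t in 𝓝[≠] (0 : ℂ), (Q.map (Polynomial.evalRingHom (γ t))).eval (η t)⁻¹ = 0) :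
    UnprojectedDense {w : Fin 2 ⊕ Fin 2 → ℂ | ∃ t : ℂ, w (Sum.inl 0) = g₀.eval t ∧
      w (Sum.inl 1) = g₁.eval t ∧ MvPolynomial.eval ![t, w (Sum.inr 0)] P = 0} := by
  by_contra hnot
  have hQirr : Irreducible Q := (irreducible_rows_iff hP).1 hirr
  obtain ⟨z₀, ρ, L, hLan, hρan, hρ0, hQρ, hL, hLalg⟩ :=
    exists_algebraic_log_of_not_dense_ramified_param g₀ g₁ hd hlt Q hP hirr hQ1 hk hψ hθ0 hψ0 hbranch
      hnot
  exact not_isAlgebraic_log_algebraicBranch_param_pole Q hQirr hQ1 hQ00 hγan hηan hη0 hγ' hηne hQγ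
    hρan hLan hρ0 hQρ hL hLalg

/-! ## Part B. Every fibre curve involving `t` is dense over a polynomial curve -/

/-- **Every fibre curve over a polynomial curve with `1 ≤ deg g₀ < deg g₁` has Zariski-dense
exponential points.**  `P` irreducible with rows `Q` of positive `t`-degree (here `t = y₀`!) and of
degree `≤ N` in the curve parameter; the top row `T` has a nonzero root `θ`; the lowest row
`q₀ ≠ 0` has a root `a`.
[cite: MantovaMasser2023, §1 Further remarks, p. 5 (the question, open in general)] (new) -/
theorem unprojectedDense_param_fibreCurve (hd : 1 ≤ g₀.natDegree)
    (hlt : g₀.natDegree < g₁.natDegree) (Q : Polynomial (Polynomial ℂ))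
    {P : MvPolynomial (Fin 2) ℂ}
    (hP : ∀ x y : ℂ, MvPolynomial.eval ![x, y] P = (Q.map (Polynomial.evalRingHom x)).eval y)
    (hirr : Irreducible P) (hQ1 : Q.natDegree ≠ 0) (N : ℕ) (hN : ∀ j, (Q.coeff j).natDegree ≤ N)
    (T : Polynomial ℂ) (hT : ∀ j, T.coeff j = (Q.coeff j).coeff N) (hT0 : T ≠ 0) {θ : ℂ} (hθ0 : θ ≠ 0)
    (hTθ : T.IsRoot θ) (hQ00 : Q.coeff 0 ≠ 0) {a : ℂ} (ha : (Q.coeff 0).IsRoot a) :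
    UnprojectedDense {w : Fin 2 ⊕ Fin 2 → ℂ | ∃ t : ℂ, w (Sum.inl 0) = g₀.eval t ∧
      w (Sum.inl 1) = g₁.eval t ∧ MvPolynomial.eval ![t, w (Sum.inr 0)] P = 0} := by
  have hQirr : Irreducible Q := (irreducible_rows_iff hP).1 hirr
  obtain ⟨k, ψ, hk, hψ, hψ0, hbranch⟩ := exists_fibreCycle_puiseux Q hQirr hQ1 N hN T hT hT0 hTθ
  obtain ⟨e, η, he, hηan, hη0, hηne, hQη⟩ := exists_zeroBranch_puiseux Q hQirr hQ1 hQ00 ha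
  exact unprojectedDense_param_cycle_zeroBranch g₀ g₁ hd hlt Q hP hirr hQ1 hk hψ hθ0 hψ0 hbranch
    (analyticAt_const.add (analyticAt_id.pow e)) hηan hη0 (deriv_newtonBase_ne_zero a he) hηne hQη

/-- **Every fibre curve involving `t` whose top `t`-row reaches both extreme `y₀`-columns is dense
over a polynomial curve with `1 ≤ deg g₀ < deg g₁`.**  `P ∈ ℂ[t, y₀]` irreducible with two monomials
of different `y₀`-degree and a monomial involving `t`; the rightmost (resp. leftmost) monomial of the
top `t`-row is rightmost (resp. leftmost) in all of `supp P` (conditions (iv), (v) of gen 21's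
residual theorem).
[cite: MantovaMasser2023, §1 Further remarks, p. 5 (the question, open in general)] (new) -/
theorem unprojectedDense_param_fibreCurve_of_support (hd : 1 ≤ g₀.natDegree)
    (hlt : g₀.natDegree < g₁.natDegree) {P : MvPolynomial (Fin 2) ℂ} (hirr : Irreducible P)
    (h1 : ∃ v ∈ P.support, ∃ v' ∈ P.support, v 1 ≠ v' 1) (hx : ∃ v ∈ P.support, v 0 ≠ 0)
    (hR : ∀ v₀ ∈ P.support, (∀ v ∈ P.support, v 0 ≤ v₀ 0) →
      (∀ v ∈ P.support, v 0 = v₀ 0 → v 1 ≤ v₀ 1) → ∀ v ∈ P.support, v 1 ≤ v₀ 1)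
    (hL : ∀ v₀ ∈ P.support, (∀ v ∈ P.support, v 0 ≤ v₀ 0) →
      (∀ v ∈ P.support, v 0 = v₀ 0 → v₀ 1 ≤ v 1) → ∀ v ∈ P.support, v₀ 1 ≤ v 1) :
    UnprojectedDense {w : Fin 2 ⊕ Fin 2 → ℂ | ∃ t : ℂ, w (Sum.inl 0) = g₀.eval t ∧
      w (Sum.inl 1) = g₁.eval t ∧ MvPolynomial.eval ![t, w (Sum.inr 0)] P = 0} := by
  classical
  -- the degree `N₀` in `t` and the top row
  have hsupp : P.support.Nonempty := by
    rw [Finset.nonempty_iff_ne_empty, Ne, MvPolynomial.support_eq_empty]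
    exact hirr.ne_zero
  obtain ⟨v₀, hv₀, hv₀max⟩ := Finset.exists_max_image P.support (fun v : Fin 2 →₀ ℕ => v 0) hsupp
  set N₀ := v₀ 0 with hN₀
  have hN : ∀ v ∈ P.support, v 0 ≤ N₀ := hv₀max
  set top := P.support.filter (fun v : Fin 2 →₀ ℕ => v 0 = N₀) with htop
  have htopne : top.Nonempty := ⟨v₀, Finset.mem_filter.2 ⟨hv₀, rfl⟩⟩
  obtain ⟨vR, hvRtop, hvRmax⟩ := Finset.exists_max_image top (fun v : Fin 2 →₀ ℕ => v 1) htopne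
  obtain ⟨vL, hvLtop, hvLmin⟩ := Finset.exists_min_image top (fun v : Fin 2 →₀ ℕ => v 1) htopne
  obtain ⟨hvR, hvR0⟩ := Finset.mem_filter.1 hvRtop
  obtain ⟨hvL, hvL0⟩ := Finset.mem_filter.1 hvLtop
  -- (iv), (v): `vR` is rightmost and `vL` is leftmost in the whole support
  have hrle : ∀ v ∈ P.support, v 1 ≤ vR 1 :=
    hR vR hvR (fun v hv => hvR0 ▸ hN v hv) fun v hv hv0 =>
      hvRmax v (Finset.mem_filter.2 ⟨hv, hv0.trans hvR0⟩)
  have hlle : ∀ v ∈ P.support, vL 1 ≤ v 1 :=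
    hL vL hvL (fun v hv => hvL0 ▸ hN v hv) fun v hv hv0 =>
      hvLmin v (Finset.mem_filter.2 ⟨hv, hv0.trans hvL0⟩)
  set r := vR 1 with hr
  obtain ⟨u, hu, hu1⟩ := exists_support_snd_eq_zero_of_irreducible P hirr h1
  have hvL1 : vL 1 = 0 := Nat.le_zero.1 (hu1 ▸ hlle u hu)
  -- the rows `Q` and the top row `T`
  set Q : Polynomial (Polynomial ℂ) :=
    ∑ v ∈ P.support, Polynomial.monomial (v 1) (Polynomial.monomial (v 0) (P.coeff v)) with hQ
  set T : Polynomial ℂ := ∑ v ∈ P.support.filter (fun v : Fin 2 →₀ ℕ => v 0 = N₀),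
    Polynomial.C (P.coeff v) * Polynomial.X ^ (v 1) with hTdef
  have hPQ : ∀ x y : ℂ, MvPolynomial.eval ![x, y] P = (Q.map (Polynomial.evalRingHom x)).eval y :=
    fun x y => eval_eq_rowsPP P x y
  have hNQ : ∀ j, (Q.coeff j).natDegree ≤ N₀ := fun j => natDegree_coeff_rowsPP_le P hN j
  have hQdeg : Q.natDegree = r := natDegree_rowsPP_eq P hrle ⟨vR, hvR, rfl⟩
  have hT : ∀ j, T.coeff j = (Q.coeff j).coeff N₀ := fun j =>
    coeff_topRowSum_eq_coeff_coeff_rowsPP P N₀ j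
  have hTcoeff : ∀ j, T.coeff j = P.coeff (Finsupp.single 0 N₀ + Finsupp.single 1 j) :=
    fun j => coeff_topRowSum P N₀ j
  have hTr : T.coeff r ≠ 0 := by
    rw [hTcoeff, ← hvR0, hr, ← Literature.NumberTheory.EllipticCurves.finsupp_fin_two_eq vR]
    exact MvPolynomial.mem_support_iff.1 hvR
  have hT0c : T.coeff 0 ≠ 0 := by
    rw [hTcoeff, ← hvL0, ← hvL1, ← Literature.NumberTheory.EllipticCurves.finsupp_fin_two_eq vL]
    exact MvPolynomial.mem_support_iff.1 hvL
  have hT0 : T ≠ 0 := fun h => hTr (by rw [h, Polynomial.coeff_zero])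
  -- `r ≥ 1`, `N₀ ≥ 1`
  have hr1 : 1 ≤ r := by
    obtain ⟨v, hv, v', hv', hvv'⟩ := h1
    have h1' := hrle v hv
    have h2' := hrle v' hv'
    omega
  have hN1 : 1 ≤ N₀ := by
    obtain ⟨v, hv, hv0⟩ := hx
    have := hN v hv
    omega
  -- a nonzero root of `T` and a root of `q₀`
  have hTdeg' : 0 < T.degree := by
    have h : (r : WithBot ℕ) ≤ T.degree := Polynomial.le_degree_of_ne_zero hTr
    exact lt_of_lt_of_le (by exact_mod_cast hr1) h
  obtain ⟨θ, hθ⟩ := Complex.exists_root hTdeg'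
  have hθ0 : θ ≠ 0 := by
    rintro rfl
    apply hT0c
    rw [Polynomial.coeff_zero_eq_eval_zero]; exact hθ
  have hQ00 : Q.coeff 0 ≠ 0 := by
    intro h
    apply hT0c
    rw [hT, h, Polynomial.coeff_zero]
  have hq0deg : 0 < (Q.coeff 0).degree := by
    have h : (N₀ : WithBot ℕ) ≤ (Q.coeff 0).degree :=
      Polynomial.le_degree_of_ne_zero (by rw [← hT]; exact hT0c)
    exact lt_of_lt_of_le (by exact_mod_cast hN1) h
  obtain ⟨a, ha⟩ := Complex.exists_root hq0deg
  have hQ1 : Q.natDegree ≠ 0 := by rw [hQdeg]; omega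
  exact unprojectedDense_param_fibreCurve g₀ g₁ hd hlt Q hPQ hirr hQ1 N₀ hNQ T hT hT0 hθ0 hθ hQ00 ha

end Master

end Summit.Schanuel.Schanuel.Theorems
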